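import Literature.MathematicalPhysics.KineticTheory.HardSphereCanonicalKSLimit
import Mathlib.Analysis.InnerProductSpace.Projection.Reflection
import HarnessLib

/-!
# The contact-scale limit of the canonical dumbbell probability
# (stub `stub_eqDumbbellLimit` of line `Sketch` v5, crux `LambertianContactSwap.ContactAngleEquidistribution`,
# stmt-AtomisticToContinuum-12097; lead `prover-line-stmt-AtomisticToContinuum-12097-c2-0`)

WHAT. At small reduced density `σ` (`SmallDensity uniformProfile σ`), the normalised pinned probability
`vcan ε_N (N+1) (x + (ε_N/2)ω, x − (ε_N/2)ω)` of a CONTACT DUMBBELL (two pinned sphere centres at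
minimal-image distance exactly the diameter `ε_N = hsDiameter σ N`) converges as `N → ∞` to a constant
`g₀ ≥ 0`, UNIFORMLY in the midpoint `x ∈ 𝕋³` and the unit normal `ω ∈ S²`.

HOW. The constant is the contact value `g₀ = gLim σ 2 (e/2, −e/2)` of Ruelle's infinite-volume pair
correlation function (density normalisation) at a fixed unit vector `e`.  The thermodynamic limit of
the canonical correlation functions at contact scale (`ksInv_eventually`, window `L = 1`, error
`δ/16`, `k = 2` points) compares `vcan` of the dumbbell with `gLim σ 2` of its lift about the midpoint
`x`, which is `(ω/2, −ω/2)` (the chart `reprSym ∘ proj` is the identity on vectors of norm `< 1/2`,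
and `ε_N/2 < 1/4`); isotropy of the infinite-volume correlation functions
(`HardSphereKS.ksCorr_linearIsometryEquiv`, applied to the reflection `Submodule.reflection_sub`
mapping `ω` to `e`) identifies `gLim σ 2 (ω/2, −ω/2)` with `g₀`; finally `g₀ ≥ 0` because `vcan ≥ 0`
and the approximation holds for every `δ > 0` at some `N`.

References: D. Ruelle, *Statistical Mechanics: Rigorous Results* (1969), §4.2.3, Thm 4.2.3;
E. Pulvirenti, D. Tsagkarogiannis, Comm. Math. Phys. 316 (2012) 289–306, Thm 2.1.
-/

noncomputable section

open MeasureTheory Filter Set Topology ProbabilityTheory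
open scoped ENNReal BigOperators Classical RealInnerProductSpace

namespace Summit.AtomisticToContinuum.HydrodynamicLimit.Theorems.ContactAngleEquidistributionSketch

open Literature.Analysis.FluidPDE Literature.MathematicalPhysics.KineticTheory
open Literature.MathematicalPhysics.StatisticalMechanics

/-- The lift about the midpoint `x` of the contact dumbbell `(x + (ε/2)ω, x − (ε/2)ω)` (`‖ω‖ = 1`,
`0 < ε < 1/2`) is `(ω/2, −ω/2)`, and both points are within minimal-image distance `ε` of `x`.
[folklore] -/
theorem liftAt_dumbbell {ε : ℝ} (hε : 0 < ε) (hε2 : ε < 1 / 2) (x : T3) {ω : V3} (hω : ‖ω‖ = 1) :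
    liftAt ε x ![x + Literature.Analysis.FunctionSpaces.Torus.proj ((ε / 2) • ω),
        x + Literature.Analysis.FunctionSpaces.Torus.proj (-((ε / 2) • ω))] =
      ![(2 : ℝ)⁻¹ • ω, -((2 : ℝ)⁻¹ • ω)] ∧
    ∀ a, Torus.euclidDist (![x + Literature.Analysis.FunctionSpaces.Torus.proj ((ε / 2) • ω),
        x + Literature.Analysis.FunctionSpaces.Torus.proj (-((ε / 2) • ω))] a) x < 1 * ε := by
  have hn : ‖(ε / 2) • ω‖ = ε / 2 := by
    rw [norm_smul, Real.norm_eq_abs, abs_of_pos (by positivity), hω, mul_one]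
  have hnorm : ‖(ε / 2) • ω‖ < 1 / 2 := by rw [hn]; linarith
  have hnorm' : ‖-((ε / 2) • ω)‖ < 1 / 2 := by rwa [norm_neg]
  have h0 : Torus.reprSym (x + Literature.Analysis.FunctionSpaces.Torus.proj ((ε / 2) • ω) - x) =
      (ε / 2) • ω := by
    rw [add_sub_cancel_left]; exact reprSym_proj_of_norm_lt hnorm
  have h1 : Torus.reprSym (x + Literature.Analysis.FunctionSpaces.Torus.proj (-((ε / 2) • ω)) - x) =
      -((ε / 2) • ω) := by
    rw [add_sub_cancel_left]; exact reprSym_proj_of_norm_lt hnorm'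
  have hc : ε⁻¹ * (ε / 2) = (2 : ℝ)⁻¹ := by field_simp
  refine ⟨?_, ?_⟩
  · funext a
    revert a
    rw [Fin.forall_fin_two]
    simp only [liftAt, Matrix.cons_val_zero, Matrix.cons_val_one, Matrix.cons_val_fin_one, h0, h1,
      smul_neg, smul_smul, hc, and_self]
  · rw [Fin.forall_fin_two]
    simp only [Matrix.cons_val_zero, Matrix.cons_val_one, Matrix.cons_val_fin_one,
      Torus.euclidDist_eq, h0, h1, norm_neg, hn, one_mul]
    exact ⟨by linarith, by linarith⟩

/-- **Isotropy of the contact value**: `gLim σ 2 (ω/2, −ω/2)` does not depend on the unit vector `ω`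
(invariance of Ruelle's infinite-volume correlation functions under the reflection swapping `ω`
and `e`). [cite: Ruelle1969, §4.2.3 Thm 4.2.3] -/
theorem gLim_dumbbell_eq {σ : ℝ} (h : SmallDensity uniformProfile σ) {ω e : V3} (hω : ‖ω‖ = 1)
    (he : ‖e‖ = 1) :
    gLim σ 2 ![(2 : ℝ)⁻¹ • ω, -((2 : ℝ)⁻¹ • ω)] = gLim σ 2 ![(2 : ℝ)⁻¹ • e, -((2 : ℝ)⁻¹ • e)] := by
  set f : V3 ≃ₗᵢ[ℝ] V3 := Submodule.reflection (ℝ ∙ (ω - e))ᗮ with hf_def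
  have hf : f ω = e := Submodule.reflection_sub (by rw [hω, he])
  have key := HardSphereKS.ksCorr_linearIsometryEquiv (by norm_num : (0 : ℝ) < 3)
    (ksRatio_three_lt_one h) f 2 ![(2 : ℝ)⁻¹ • ω, -((2 : ℝ)⁻¹ • ω)]
  have hfx : (fun i => f (![(2 : ℝ)⁻¹ • ω, -((2 : ℝ)⁻¹ • ω)] i)) =
      ![(2 : ℝ)⁻¹ • e, -((2 : ℝ)⁻¹ • e)] := by
    funext i
    revert i
    rw [Fin.forall_fin_two]
    simp only [Matrix.cons_val_zero, Matrix.cons_val_one, Matrix.cons_val_fin_one, map_neg,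
      LinearIsometryEquiv.map_smul, hf, and_self]
  rw [hfx] at key
  exact key.symm

/-- **Registered sub-goal `stub_eqDumbbellLimit`** (line `Sketch` v5, crux ContactAngleEquidistribution,
stmt-AtomisticToContinuum-12097): at small reduced density the normalised pinned probability of a
CONTACT DUMBBELL, `vcan ε_N (N+1) (x + (ε_N/2)ω, x − (ε_N/2)ω)`, converges as `N → ∞` to a constant
`g₀ ≥ 0` (the contact value `gLim σ 2 (e/2, −e/2)` of Ruelle's infinite-volume pair correlation, the
same for every unit `e` by isotropy), UNIFORMLY in the midpoint `x ∈ 𝕋³` and the unit normal `ω`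
(`ksInv_eventually` with window `L = 1`, `k = 2`; the lift of the dumbbell about `x` is `(ω/2, −ω/2)`;
`g₀ ≥ 0` because `vcan ≥ 0`).
[cite: Ruelle1969, §4.2.3 Thm 4.2.3; PulvirentiTsagkarogiannis2012, Thm 2.1] -/
theorem stub_eqDumbbellLimit {σ : ℝ} (h : SmallDensity uniformProfile σ) :
    ∃ g₀ : ℝ, 0 ≤ g₀ ∧ ∀ δ : ℝ, 0 < δ → ∀ᶠ N : ℕ in atTop, ∀ (x : T3) (ω : V3), ‖ω‖ = 1 →
      |vcan (hsDiameter σ N) (N + 1)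
          ![x + Literature.Analysis.FunctionSpaces.Torus.proj ((hsDiameter σ N / 2) • ω),
            x + Literature.Analysis.FunctionSpaces.Torus.proj (-((hsDiameter σ N / 2) • ω))] - g₀| ≤ δ := by
  obtain ⟨e, he⟩ : ∃ e : V3, ‖e‖ = 1 := ⟨EuclideanSpace.single 0 1, by simp⟩
  have main : ∀ δ : ℝ, 0 < δ → ∀ᶠ N : ℕ in atTop, ∀ (x : T3) (ω : V3), ‖ω‖ = 1 →
      |vcan (hsDiameter σ N) (N + 1)
          ![x + Literature.Analysis.FunctionSpaces.Torus.proj ((hsDiameter σ N / 2) • ω),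
            x + Literature.Analysis.FunctionSpaces.Torus.proj (-((hsDiameter σ N / 2) • ω))] -
        gLim σ 2 ![(2 : ℝ)⁻¹ • e, -((2 : ℝ)⁻¹ • e)]| ≤ δ := by
    intro δ hδ
    filter_upwards [ksInv_eventually h 1 (δ := δ / 16) (by positivity)] with N hN x ω hω
    have hε : 0 < hsDiameter σ N := hsDiameter_pos h.σ_pos N
    have hε2 : hsDiameter σ N < 1 / 2 := (hsDiameter_le h.σ_pos.le N).trans_lt h.σ_lt_half
    obtain ⟨hlift, hclose⟩ := liftAt_dumbbell hε hε2 x hω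
    have hks := hN 2 _ x hclose
    rw [hlift, gLim_dumbbell_eq h hω he] at hks
    calc _ ≤ δ / 16 * 4 ^ 2 := hks
      _ = δ := by norm_num
  refine ⟨gLim σ 2 ![(2 : ℝ)⁻¹ • e, -((2 : ℝ)⁻¹ • e)], ?_, main⟩
  refine le_of_forall_pos_lt_add fun δ hδ => ?_
  obtain ⟨N, hN⟩ := (main (δ / 2) (by positivity)).exists
  have h1 := hN 0 e he
  have h2 := vcan_nonneg (hsDiameter σ N) (N + 1)
    ![(0 : T3) + Literature.Analysis.FunctionSpaces.Torus.proj ((hsDiameter σ N / 2) • e),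
      0 + Literature.Analysis.FunctionSpaces.Torus.proj (-((hsDiameter σ N / 2) • e))]
  rw [abs_le] at h1
  linarith [h1.2]

end Summit.AtomisticToContinuum.HydrodynamicLimit.Theorems.ContactAngleEquidistributionSketch

end
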